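import Summits.ABC.ABC.Theses.IneffectiveSubspace

/-!
# `DepthCountedABC` (stmt-ABC-14938): load-bearing hypotheses of the crux

Negative-side support lemmas for the crux `Summit.ABC.ABC.Theses.IneffectiveSubspace.DepthCountedABC`
(abc with a constant `C(K, ε)` on each depth cell `ω₅(abc) := #{p : p⁵ ∣ abc} ≤ K`), from the crux
disprover's cycle-1 attack (`Cruxes/DepthCountedABC/Disproof.lean`, sections A–B):

* `depthCountedABC_false_without_coprime` — dropping `Nat.Coprime a b` (keeping positivity and
  `a + b = c`) is fatal already on the cell `K = 1`: `(2ⁿ, 2ⁿ, 2ⁿ⁺¹)` has `abc = 2^(3n+1)`,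
  `rad = 2`, `c = 2ⁿ⁺¹` unbounded.  Any proof must use coprimality.
* `depthCountedABC_false_without_sum` — dropping `a + b = c` (keeping positivity and even pairwise
  coprimality) is fatal on the cell `K = 1`: `(1, 1, 2ⁿ)`.  Any proof must use the equation.
* `eq_one_of_coprime_of_zero` — positivity of `a, b` is NOT load-bearing given coprimality: `a = 0`
  or `b = 0` only admits `c = 1`.
* `depthCountedABC_kUniform_iff_abc` — the `K`-uniform strengthening (one `C(ε)` for all cells) is
  literally `ABC`, and dropping the cell condition is `ABC` (`depthCountedABC_withoutDepth_iff_abc`):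
  the crux is `ABC` minus uniformity in `K`, nothing else.
-/

set_option linter.dupNamespace false

namespace Summit.ABC.ABC.Theorems.DepthCountedABC.Negative

open Literature.NumberTheory.DiophantineGeometry UniqueFactorizationMonoid

/-- If every prime `p` with `p⁵ ∣ n` lies in `S`, then `ω₅(n) ≤ #S`. [folklore] -/
theorem card_deep_le_card {n : ℕ} (hn : n ≠ 0) (S : Finset ℕ)
    (h : ∀ p, p.Prime → p ^ 5 ∣ n → p ∈ S) :
    (n.primeFactors.filter (fun p => 5 ≤ n.factorization p)).card ≤ S.card := by
  apply Finset.card_le_card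
  intro p hp
  rw [Finset.mem_filter] at hp
  have hpp := Nat.prime_of_mem_primeFactors hp.1
  exact h p hpp ((hpp.pow_dvd_iff_le_factorization hn).mpr hp.2)

/-- Powers of a prime have `ω₅ ≤ 1`. [folklore] -/
theorem card_deep_prime_pow_le_one {p m : ℕ} (hp : p.Prime) :
    ((p ^ m).primeFactors.filter (fun q => 5 ≤ (p ^ m).factorization q)).card ≤ 1 := by
  have hn : p ^ m ≠ 0 := pow_ne_zero _ hp.ne_zero
  have := card_deep_le_card hn {p} (fun q hq h5 => by
    rw [Finset.mem_singleton]
    exact (Nat.prime_dvd_prime_iff_eq hq hp).mp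
      (hq.dvd_of_dvd_pow (dvd_trans (dvd_pow_self q (by norm_num)) h5)))
  simpa using this

/-- The radical of a prime power `p^m`, `m ≠ 0`, is `p`. [folklore] -/
theorem radical_prime_pow_eq {p m : ℕ} (hp : p.Prime) (hm : m ≠ 0) : radical (p ^ m) = p := by
  rw [Nat.radical_eq_prod_primeFactors, Nat.primeFactors_prime_pow hm hp, Finset.prod_singleton]

/-- Real-arithmetic core of both witnesses: `2^(n+1) < C · 2^(1+1)` fails once `4C < 2^n`. [folklore] -/
theorem exists_two_pow_not_lt (C : ℝ) :
    ∃ n : ℕ, 1 ≤ n ∧ ¬ ((2 : ℝ) ^ (n + 1) < C * (2 : ℝ) ^ ((1 : ℝ) + 1)) := by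
  obtain ⟨n, hn⟩ := pow_unbounded_of_one_lt (4 * C) (by norm_num : (1 : ℝ) < 2)
  refine ⟨n + 1, by omega, ?_⟩
  have h4 : (2 : ℝ) ^ ((1 : ℝ) + 1) = 4 := by
    rw [show (1 : ℝ) + 1 = ((2 : ℕ) : ℝ) by norm_num, Real.rpow_natCast]; norm_num
  rw [h4, not_lt]
  have : (2 : ℝ) ^ (n + 1 + 1) = 4 * 2 ^ n := by ring
  rw [this]
  nlinarith [pow_pos (by norm_num : (0 : ℝ) < 2) n]

/-- **Coprimality is load-bearing for `DepthCountedABC`.**  The crux with `Nat.Coprime a b` dropped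
(positivity and `a + b = c` kept) is false: `(2ⁿ, 2ⁿ, 2ⁿ⁺¹)` lies in the cell `K = 1`
(`abc = 2^(3n+1)`, `rad(abc) = 2`) and `c = 2ⁿ⁺¹` is unbounded against `C · 2^(1+ε)` (`ε = 1`).
[folklore] -/
theorem depthCountedABC_false_without_coprime :
    ¬ ∀ K : ℕ, ∀ ε : ℝ, 0 < ε → ∃ C : ℝ, 0 < C ∧ ∀ a b c : ℕ, 0 < a → 0 < b → a + b = c →
      ((a * b * c).primeFactors.filter (fun p => 5 ≤ (a * b * c).factorization p)).card ≤ K →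
      (c : ℝ) < C * ((rad a b c : ℕ) : ℝ) ^ (1 + ε) := by
  intro h
  obtain ⟨C, _hC, hh⟩ := h 1 1 one_pos
  obtain ⟨n, _hn1, hn⟩ := exists_two_pow_not_lt C
  have hprod : 2 ^ n * 2 ^ n * 2 ^ (n + 1) = 2 ^ (3 * n + 1) := by ring
  have hK : ((2 ^ n * 2 ^ n * 2 ^ (n + 1)).primeFactors.filter
      (fun p => 5 ≤ (2 ^ n * 2 ^ n * 2 ^ (n + 1)).factorization p)).card ≤ 1 := by
    rw [hprod]; exact card_deep_prime_pow_le_one Nat.prime_two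
  have hrad : rad (2 ^ n) (2 ^ n) (2 ^ (n + 1)) = 2 := by
    rw [rad_def, hprod]; exact radical_prime_pow_eq Nat.prime_two (by omega)
  have := hh (2 ^ n) (2 ^ n) (2 ^ (n + 1)) (by positivity) (by positivity) (by ring) hK
  rw [hrad] at this
  push_cast at this
  exact hn this

/-- **The equation `a + b = c` is load-bearing for `DepthCountedABC`.**  The crux with `a + b = c`
dropped (positivity and pairwise coprimality kept) is false: `(1, 1, 2ⁿ)` lies in the cell `K = 1`,
`rad = 2`, and `c = 2ⁿ` is unbounded against `C · 2^(1+ε)`. [folklore] -/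
theorem depthCountedABC_false_without_sum :
    ¬ ∀ K : ℕ, ∀ ε : ℝ, 0 < ε → ∃ C : ℝ, 0 < C ∧ ∀ a b c : ℕ, 0 < a → 0 < b → 0 < c →
      Nat.Coprime a b → Nat.Coprime a c → Nat.Coprime b c →
      ((a * b * c).primeFactors.filter (fun p => 5 ≤ (a * b * c).factorization p)).card ≤ K →
      (c : ℝ) < C * ((rad a b c : ℕ) : ℝ) ^ (1 + ε) := by
  intro h
  obtain ⟨C, _hC, hh⟩ := h 1 1 one_pos
  obtain ⟨n, _hn1, hn⟩ := exists_two_pow_not_lt C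
  have hprod : 1 * 1 * 2 ^ (n + 1) = 2 ^ (n + 1) := by ring
  have hK : ((1 * 1 * 2 ^ (n + 1)).primeFactors.filter
      (fun p => 5 ≤ (1 * 1 * 2 ^ (n + 1)).factorization p)).card ≤ 1 := by
    rw [hprod]; exact card_deep_prime_pow_le_one Nat.prime_two
  have hrad : rad 1 1 (2 ^ (n + 1)) = 2 := by
    rw [rad_def, hprod]; exact radical_prime_pow_eq Nat.prime_two (by omega)
  have := hh 1 1 (2 ^ (n + 1)) one_pos one_pos (by positivity) (Nat.coprime_one_left 1)
    (Nat.coprime_one_left _) (Nat.coprime_one_left _) hK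
  rw [hrad] at this
  push_cast at this
  exact hn this

/-- **Positivity is NOT load-bearing given coprimality**: with `a + b = c` and `Nat.Coprime a b`,
`a = 0` or `b = 0` forces `c = 1` (`gcd(0, b) = b`), a triple with `c < C` for any `C > 1`.  So the
positivity clauses of `IsABCTriple` matter only through `C ↦ max C 2`; no proof step can hinge on them.
[folklore] -/
theorem eq_one_of_coprime_of_zero {a b c : ℕ} (hsum : a + b = c) (hcop : Nat.Coprime a b)
    (h0 : a = 0 ∨ b = 0) : c = 1 := by
  rcases h0 with rfl | rfl
  · simp [Nat.coprime_zero_left] at hcop; omega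
  · simp [Nat.coprime_zero_right] at hcop; omega

/-- **Dropping the cell condition gives `ABC` verbatim** (the then-vacuous binder `∀ K` aside): the
crux is exactly `ABC` restricted cell by cell. [folklore] -/
theorem depthCountedABC_withoutDepth_iff_abc :
    (∀ K : ℕ, ∀ ε : ℝ, 0 < ε → ∃ C : ℝ, 0 < C ∧ ∀ a b c : ℕ, IsABCTriple a b c →
      (c : ℝ) < C * ((rad a b c : ℕ) : ℝ) ^ (1 + ε)) ↔ _root_.ABC := by
  rw [ABC_iff]
  exact ⟨fun h => h 0, fun h _ => h⟩

/-- **The `K`-uniform strengthening is `ABC`.**  One constant `C(ε)` serving every cell is literally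
the summit statement (take `K := ω₅(abc)`); so the whole content of the crux relative to `ABC` is the
freedom of `C` to depend on `K`. [folklore] -/
theorem depthCountedABC_kUniform_iff_abc :
    (∀ ε : ℝ, 0 < ε → ∃ C : ℝ, 0 < C ∧ ∀ K : ℕ, ∀ a b c : ℕ, IsABCTriple a b c →
      ((a * b * c).primeFactors.filter (fun p => 5 ≤ (a * b * c).factorization p)).card ≤ K →
      (c : ℝ) < C * ((rad a b c : ℕ) : ℝ) ^ (1 + ε)) ↔ _root_.ABC := by
  rw [ABC_iff]
  constructor
  · intro h ε hε
    obtain ⟨C, hC, hh⟩ := h ε hε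
    exact ⟨C, hC, fun a b c ht => hh _ a b c ht le_rfl⟩
  · intro h ε hε
    obtain ⟨C, hC, hh⟩ := h ε hε
    exact ⟨C, hC, fun K a b c ht _ => hh a b c ht⟩

end Summit.ABC.ABC.Theorems.DepthCountedABC.Negative
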